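import Summits.AtomisticToContinuum.Crystallization.Theorems.FrustratedLawDichotomyCertFloorTails
import Summits.AtomisticToContinuum.Crystallization.Theorems.FrustratedLawDichotomyWindowSymmetry

/-!
# FrustratedLawDichotomy · crux `AperiodicFrustratedLawGap` (stmt-AtomisticToContinuum-27623) — TRUNCATION TAILS FOR THE CLASS-A CERTIFICATE FLOOR, IV:
# THE HOST FORCE TERM BY MIRROR SYMMETRY (hdef side, class A; decomp-a2c hand-1 g52, companion of `…CertFloorTails`; uses NODE-11 `…WindowSymmetry`)

Column (d) of CELLSOUND-g112 §1 — the signed host term `Σ_{x∈I} ⟪y_x, H_x⟫`, `H_x = Σ_{x'∈a∖x} ljBondForce (x − x')` of `certFloor` (T2, (226)) — needs, as it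
stands, `|I|·|a| ≈ 7·10⁶` bond-force evaluations per cell.  For a template that is MIRROR-CLOSED INSIDE ITS WINDOW (every Bravais host: fcc and all its
affine strains — `a ∋ 2x − x'` whenever `x, x' ∈ a` and `‖2x − x'‖ ≤ R_w`) the force of the mirror-symmetric core around each site vanishes
(`…WindowSymmetry.sum_ljForce_eq_zero_of_neg_mem`), and what is left are bonds LONGER than `R_w − ‖x‖`, booked by the shell sum `T0_δ`:

* `hostForce_eq_sum_unmirrored` (general `V`) — `Σ_{x'∈a∖x} g(x − x') = Σ_{x'∈a∖x, 2x−x'∉a} g(x − x')` EXACTLY (the K-file may evaluate this short rest);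
* `norm_ljBondForce_le` — `‖g v‖ ≤ ‖v‖⁻⁷ + ‖v‖⁻¹³`;
* ★ `norm_hostForce_le_of_mirror` (`E3`) — if every `x' ∈ a` with `dist x' x < ρ` has its mirror `2x − x'` in `a` (`ρ ≥ δ/2`, `a` `δ`-separated), then
  `‖H_x‖ ≤ T0_δ(ρ) = S₄(δ,ρ) + S₁₀(δ,ρ)`;
* ★★ `hostColumn_abs_le_of_window` — for a template mirror-closed inside the window radius `R_w` and interior sites with `‖x‖ + δ/2 ≤ R_w`:
  `|Σ_{x∈I} ⟪y_x, H_x⟫| ≤ Σ_{x∈I} ‖y_x‖·T0_δ(R_w − ‖x‖)` — NO force evaluation at all (same size as the far force column (e); dial with `Rc`).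
Non-Bravais hosts (hcp, stackings): not mirror-closed at general sites — evaluate the rest of `hostForce_eq_sum_unmirrored` or the shells (census).
DEF-FREE; imports TREE `…CertFloorTails` (p859293) and `…WindowSymmetry` (210); 0 sorry.  All `[folklore]`.
-/

noncomputable section

namespace Summit.AtomisticToContinuum.Crystallization.Theorems.FrustratedLawDichotomyCertFloorTailsHost

open Metric Set RealInnerProductSpace
open scoped BigOperators
open Summit.AtomisticToContinuum.Crystallization.Theorems.ChargedEnergyGapNegative (E3)
open Summit.AtomisticToContinuum.Crystallization.Theorems.FrustratedLawDichotomyCoherentFloorAlgebra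
open Summit.AtomisticToContinuum.Crystallization.Theorems.FrustratedLawDichotomyWindowSymmetry (sum_ljForce_eq_zero_of_neg_mem)
open Summit.AtomisticToContinuum.Crystallization.Theorems.FrustratedLawDichotomyCertFloorTails (norm_psiT_smul_le sum_psiTail_le)

/-! ## §1. The mirror-symmetric core carries no force (general `V`) -/

section General

variable {V : Type*} [NormedAddCommGroup V] [InnerProductSpace ℝ V]

/-- `‖g v‖ ≤ ‖v‖⁻⁷ + ‖v‖⁻¹³` for the bond force `g v = ψ(‖v‖²)•v`. [folklore] -/
theorem norm_ljBondForce_le (v : V) : ‖ljBondForce v‖ ≤ ‖v‖⁻¹ ^ 7 + ‖v‖⁻¹ ^ 13 :=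
  norm_psiT_smul_le v

variable [DecidableEq V]

/-- ★ EXACT: the window force at `x` equals the force of the UNMIRRORED bonds only — the bonds `x − x'` whose mirror end `2x − x'` also lies in
the template cancel in pairs (`g` odd, NODE-11). [folklore] -/
theorem hostForce_eq_sum_unmirrored (a : Finset V) (x : V) :
    ∑ x' ∈ a.erase x, ljBondForce (x - x')
      = ∑ x' ∈ (a.erase x).filter (fun x' => (2 : ℝ) • x - x' ∉ a), ljBondForce (x - x') := by
  classical
  rw [← Finset.sum_filter_add_sum_filter_not (a.erase x) (fun x' => (2 : ℝ) • x - x' ∈ a)]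
  -- the mirror-closed part sums to zero
  set M := (a.erase x).filter (fun x' => (2 : ℝ) • x - x' ∈ a) with hM
  have hinj : Set.InjOn (fun x' : V => x - x') (M : Set V) := fun u _ v _ h => sub_right_injective h
  have hW : ∀ w ∈ M.image (fun x' => x - x'), -w ∈ M.image (fun x' => x - x') := by
    intro w hw
    obtain ⟨x', hx', rfl⟩ := Finset.mem_image.mp hw
    obtain ⟨hx'e, hx'm⟩ := Finset.mem_filter.mp hx'
    obtain ⟨hx'x, hx'a⟩ := Finset.mem_erase.mp hx'e
    refine Finset.mem_image.mpr ⟨(2 : ℝ) • x - x', Finset.mem_filter.mpr ⟨Finset.mem_erase.mpr ⟨?_, hx'm⟩, ?_⟩, ?_⟩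
    · intro h
      apply hx'x
      calc x' = (2 : ℝ) • x - ((2 : ℝ) • x - x') := by abel
        _ = (2 : ℝ) • x - x := by rw [h]
        _ = x := by rw [two_smul]; abel
    · have : (2 : ℝ) • x - ((2 : ℝ) • x - x') = x' := by abel
      rw [this]; exact hx'a
    · rw [two_smul]; abel
  have h0 : ∑ x' ∈ M, ljBondForce (x - x') = 0 := by
    rw [← Finset.sum_image hinj]
    have h := sum_ljForce_eq_zero_of_neg_mem (M.image (fun x' => x - x')) hW
    refine (Finset.sum_congr rfl fun w _ => ?_).trans h
    unfold ljBondForce psiT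
    rfl
  rw [h0, zero_add]

end General

/-! ## §2. The unmirrored rest is far: shell-sum bound (`E3`) -/

/-- ★ If every template site within `ρ` of `x` has its mirror in the template (`ρ ≥ δ/2`, template `δ`-separated), then the window force at `x`
is at most `T0_δ(ρ) = S₄(δ,ρ) + S₁₀(δ,ρ)`. [folklore] -/
theorem norm_hostForce_le_of_mirror (a : Finset E3) (x : E3) {δ ρ : ℝ} (hδ : 0 < δ) (hρ : δ / 2 ≤ ρ)
    (hsep : ∀ z ∈ a, ∀ z' ∈ a, z ≠ z' → δ ≤ dist z z')
    (hmir : ∀ x' ∈ a, x' ≠ x → dist x' x < ρ → (2 : ℝ) • x - x' ∈ a) :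
    ‖∑ x' ∈ a.erase x, ljBondForce (x - x')‖
      ≤ (3 / 4 * (2 / δ) ^ 3 * ρ⁻¹ ^ 4 + 36 / 5 * (2 / δ) ^ 2 * ρ⁻¹ ^ 5 + 1 / 2 * (2 / δ) * ρ⁻¹ ^ 6 + 2 * ρ⁻¹ ^ 7)
        + (3 / 10 * (2 / δ) ^ 3 * ρ⁻¹ ^ 10 + 72 / 11 * (2 / δ) ^ 2 * ρ⁻¹ ^ 11 + 1 / 4 * (2 / δ) * ρ⁻¹ ^ 12 + 2 * ρ⁻¹ ^ 13) := by
  classical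
  rw [hostForce_eq_sum_unmirrored]
  set R := (a.erase x).filter (fun x' => (2 : ℝ) • x - x' ∉ a) with hR
  have hfar : ∀ x' ∈ R, ρ ≤ dist x' x := by
    intro x' hx'
    obtain ⟨hx'e, hx'm⟩ := Finset.mem_filter.mp hx'
    obtain ⟨hx'x, hx'a⟩ := Finset.mem_erase.mp hx'e
    by_contra h
    exact hx'm (hmir x' hx'a hx'x (not_le.mp h))
  have hsepR : ∀ u ∈ R, ∀ v ∈ R, u ≠ v → δ ≤ dist u v := fun u hu v hv huv =>
    hsep u (Finset.mem_of_mem_erase (Finset.mem_filter.mp hu).1) v (Finset.mem_of_mem_erase (Finset.mem_filter.mp hv).1) huv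
  calc ‖∑ x' ∈ R, ljBondForce (x - x')‖ ≤ ∑ x' ∈ R, ‖ljBondForce (x - x')‖ := norm_sum_le _ _
    _ ≤ ∑ x' ∈ R, ((dist x' x)⁻¹ ^ 7 + (dist x' x)⁻¹ ^ 13) := by
        refine Finset.sum_le_sum fun x' _ => ?_
        rw [dist_comm, dist_eq_norm]
        exact norm_ljBondForce_le (x - x')
    _ ≤ _ := sum_psiTail_le R x hδ hρ hsepR hfar

/-- Mirror closure INSIDE A WINDOW implies mirror closure within `R_w − ‖x‖` of each site `x`. [folklore] -/
theorem mirror_of_window (a : Finset E3) {R_w : ℝ} (hwin : ∀ x ∈ a, ∀ x' ∈ a, ‖(2 : ℝ) • x - x'‖ ≤ R_w → (2 : ℝ) • x - x' ∈ a)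
    {x : E3} (hx : x ∈ a) : ∀ x' ∈ a, x' ≠ x → dist x' x < R_w - ‖x‖ → (2 : ℝ) • x - x' ∈ a := by
  intro x' hx'a _ hd
  refine hwin x hx x' hx'a ?_
  have e : (2 : ℝ) • x - x' = x + (x - x') := by rw [two_smul]; abel
  rw [e]
  have h := norm_add_le x (x - x')
  rw [← dist_eq_norm, dist_comm] at h
  linarith

/-- ★★ **THE HOST COLUMN WITHOUT FORCE EVALUATIONS.**  Template `a` `δ`-separated and MIRROR-CLOSED INSIDE ITS WINDOW of radius `R_w`
(`x, x' ∈ a`, `‖2x − x'‖ ≤ R_w ⇒ 2x − x' ∈ a` — every Bravais host cut by a ball), interior `I ⊆ a` with `‖x‖ + δ/2 ≤ R_w`, any multipliers `y`: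
`|Σ_{x∈I} ⟪y_x, Σ_{x'∈a∖x} ljBondForce (x − x')⟫| ≤ Σ_{x∈I} ‖y_x‖·T0_δ(R_w − ‖x‖)`. [folklore] -/
theorem hostColumn_abs_le_of_window (a I : Finset E3) (y : E3 → E3) {δ R_w : ℝ} (hδ : 0 < δ)
    (hsep : ∀ z ∈ a, ∀ z' ∈ a, z ≠ z' → δ ≤ dist z z') (hIa : I ⊆ a)
    (hwin : ∀ x ∈ a, ∀ x' ∈ a, ‖(2 : ℝ) • x - x'‖ ≤ R_w → (2 : ℝ) • x - x' ∈ a) (hI : ∀ x ∈ I, ‖x‖ + δ / 2 ≤ R_w) :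
    |∑ x ∈ I, ⟪y x, ∑ x' ∈ a.erase x, ljBondForce (x - x')⟫|
      ≤ ∑ x ∈ I, ‖y x‖ *
        ((3 / 4 * (2 / δ) ^ 3 * (R_w - ‖x‖)⁻¹ ^ 4 + 36 / 5 * (2 / δ) ^ 2 * (R_w - ‖x‖)⁻¹ ^ 5 + 1 / 2 * (2 / δ) * (R_w - ‖x‖)⁻¹ ^ 6
            + 2 * (R_w - ‖x‖)⁻¹ ^ 7)
          + (3 / 10 * (2 / δ) ^ 3 * (R_w - ‖x‖)⁻¹ ^ 10 + 72 / 11 * (2 / δ) ^ 2 * (R_w - ‖x‖)⁻¹ ^ 11 + 1 / 4 * (2 / δ) * (R_w - ‖x‖)⁻¹ ^ 12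
            + 2 * (R_w - ‖x‖)⁻¹ ^ 13)) := by
  refine (Finset.abs_sum_le_sum_abs _ _).trans (Finset.sum_le_sum fun x hx => ?_)
  refine (abs_real_inner_le_norm _ _).trans (mul_le_mul_of_nonneg_left ?_ (norm_nonneg _))
  exact norm_hostForce_le_of_mirror a x hδ (by linarith [hI x hx]) hsep (mirror_of_window a hwin (hIa hx))

end Summit.AtomisticToContinuum.Crystallization.Theorems.FrustratedLawDichotomyCertFloorTailsHost

end
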